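import Summits.Ventures.YMGap.FlowData.RectTubeMassGapPrimePos
import Summits.Ventures.YMGap.FlowData.RectTubeTorelonEnvelope
import HarnessLib

/-!
# Venture YMGap, track Y3 FLOW-DATA — `SU(2)` rectangular tubes: the QUANTITATIVE two-state bound and the one-sided
# window `m′(β) ≤ (Ls μ)·(−ln(I₃(β)/I₁(β))) + 2β·#P + ln 2` (theorems only)

HONEST FRAMING: venture file of the cell `pub-ymgap` (QuantumFields programme), track Y3; companion THEOREMS for
`FlowData/RectTubeVacuumProjection.lean` (`su2RectMassGapPrime` = the FLOW-TABLE's `m′`, FLOW-PLAN O5).  Finite rectangular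
torus only; no number of the FLOW-TABLE, no row, nothing about `L → ∞`, the continuum, or a mass gap in the thermodynamic
sense.  The upper bound is a CONSISTENCY window (the `e = 0` gap never exceeds the ADJOINT-TORELON scale
`(Ls μ)(−ln(I₃/I₁)) ≈ 2(Ls μ)(−ln u)` by more than `2β#P + ln 2`); volume-UNIFORM lower bounds on `m′` are
cluster-expansion statements and are NOT claimed anywhere in this track (the finite-volume lower bound of
`RectTubeMassGapPrimeDivergence`, `m′(β) ≥ −ln(e^{β(#P+N)} − 1) − ln(20/3)`, degrades with the volume).

THE WITNESSES.  `f₁ = e^{−J mag/2}` (the strong-coupling vacuum direction) and `f₂ = e^{−J mag/2}·U₂(a₀(hol_μ))`, the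
ADJOINT character of the straight `μ`-line holonomy: both gauge invariant and twist invariant (`U₂` is even), hence in the
trivial-flux sector; `⟪f₁, T f₂⟫ = C₂ ∫ U₂(a₀(hol)) = 0` and `⟪f_i, T f_i⟫ = C_i ∫ W_i²` with `C₁ = c₀^N ≥ C₂ = c₀^{N−L}(c₂/3)^L`
(`RectTubeCharacterLine`); `‖f_i‖² ≤ e^{β#P} ∫ W_i²`.  The two-state bound of `RectTubeMassGapPrime` then gives
`½ e^{−β#P} c₀^{N−L} (c₂/3)^L ≤ ‖T ∘ (P_0 − P_Ω)‖`, and `‖T‖ ≤ e^{β#P} c₀^N`, `(c₂/3)/c₀ = I₃/I₁`.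

* **`su2_rectExcitedNorm_ge`** — `½ e^{−β#P} c₀(β)^{N−Ls μ} (c₂(β)/3)^{Ls μ} ≤ su2RectExcitedNorm β Ls` (`β > 0`, every axis `μ`;
  the qualitative `0 <` version and `m′ > 0` are in `RectTubeMassGapPrimePos`, which does not need the torelon envelope);
* **`su2RectMassGapPrime_le`** — `su2RectMassGapPrime β Ls ≤ (Ls μ)·(−log(I₃(β)/I₁(β))) + 2β·(#sites·k(k−1)/2) + log 2`.

References: M. Reed, B. Simon IV (1978) §XIII.12 [cite: ReedSimonIV1978, §XIII.12]; I. Montvay, G. Münster (1994) §3.2.6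
[cite: MontvayMunster1994, §3.2.6]; G. Münster, Nucl. Phys. B 190 (1981) 439 (strong-coupling glueball / torelon scales)
[folklore].
-/

noncomputable section

open scoped BigOperators ENNReal
open MeasureTheory Filter Function Polynomial.Chebyshev
open Literature.MathematicalPhysics.QuantumFieldTheory Literature.Analysis.OperatorTheory Literature.Analysis.FunctionSpaces
open Literature.MathematicalPhysics.QuantumLattice (RectTorusSite fundamentalRep continuous_fundamentalRep
  fundamentalRep_mem_unitaryGroup)
open Summit.Ventures.LatticeQCDFlow.Exactness Summit.Ventures.LatticeQCDFlow.Scoring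

namespace Summit.Ventures.YMGap.FlowData

/-! ### The adjoint-line witness and the window for `m′` -/

section SU2

variable {k : ℕ}

/-- **`½ e^{−β#P} c₀^{N−Ls μ} (c₂/3)^{Ls μ} ≤ ‖T ∘ (P_0 − P_Ω)‖`** for the `SU(2)` tube at every `β > 0` and every axis `μ`
(`c₀ = (I₀−I₂)(β)`, `c₂/3 = (I₂−I₄)(β)/3`, `N` links, `#P = #sites · k(k−1)/2` plaquettes): the two-state bound with the
strong-coupling vacuum direction and the adjoint Polyakov loop. [cite: MontvayMunster1994, §3.2.6] -/
theorem su2_rectExcitedNorm_ge {β : ℝ} (hβ : 0 < β) (Ls : Fin k → ℕ) [∀ i, NeZero (Ls i)] (μ : Fin k) :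
    Real.exp (-(β * (Fintype.card (RectTorusSite Ls) * Fintype.card {p : Fin k × Fin k // p.1 < p.2}))) *
        (((besselI 0 β - besselI (0 + 2) β) / ((0 : ℕ) + 1)) ^ (Fintype.card (RectTorusSite Ls × Fin k) - Ls μ) *
          ((besselI 2 β - besselI (2 + 2) β) / ((2 : ℕ) + 1)) ^ (Ls μ)) / 2 ≤
      su2RectExcitedNorm β Ls := by
  haveI : SecondCountableTopology (Matrix.specialUnitaryGroup (Fin 2) ℂ) := secondCountableTopology_su2
  classical
  set ρ := fundamentalRep (Fin 2) with hρdef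
  set J : ℝ := β / 2 with hJ
  set P : ℝ := (Fintype.card (RectTorusSite Ls) : ℝ) * (Fintype.card {p : Fin k × Fin k // p.1 < p.2} : ℝ) with hP
  set N : ℕ := Fintype.card (RectTorusSite Ls × Fin k) with hN
  set c0 : ℝ := (besselI 0 β - besselI (0 + 2) β) / ((0 : ℕ) + 1) with hc0
  set q2 : ℝ := (besselI 2 β - besselI (2 + 2) β) / ((2 : ℕ) + 1) with hq2
  set C2 : ℝ := c0 ^ (N - Ls μ) * q2 ^ (Ls μ) with hC2
  -- the vacuum package
  obtain ⟨φ₀, h1, hpos, -, hinv, -, hvac, -⟩ := exists_rectVacuum_gap ρ J (Ls := Ls)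
    (continuous_fundamentalRep (Fin 2)) fundamentalRep_mem_unitaryGroup su2MinusOne_mem_center
  -- the line, the two functions
  set ℓ : Fin (Ls μ) → RectTorusSite Ls × Fin k := fun t => (Pi.single μ ((t : ℕ) : ZMod (Ls μ)), μ) with hℓ
  set W2 : RectSlice Ls (Matrix.specialUnitaryGroup (Fin 2) ℂ) → ℝ :=
    fun b => (U ℝ ((2 : ℕ) : ℤ)).eval (su2a0 ((List.ofFn fun t : Fin (Ls μ) => b (ℓ t)).prod)) with hW2
  set m0 : RectSlice Ls (Matrix.specialUnitaryGroup (Fin 2) ℂ) → ℝ :=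
    fun b => Real.exp (-(J / 2 * rectMagSum (Ls := Ls) ρ b)) with hm0
  have hW2c : Continuous W2 :=
    (U ℝ ((2 : ℕ) : ℤ)).continuous.comp (continuous_su2a0.comp (continuous_prod_ofFn_apply (Ls μ) ℓ))
  have hIpos : ∀ n : ℕ, 0 < besselI n β := fun n => by
    rw [besselI_eq_latticeModels_besselI]; exact Literature.Probability.LatticeModels.besselI_pos hβ _
  have hm0c : Continuous m0 :=
    Real.continuous_exp.comp (continuous_const.mul (continuous_rectMagSum (Ls := Ls) ρ (continuous_fundamentalRep (Fin 2)))).neg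
  have hf1c : Continuous fun b => m0 b * (1 : ℝ) := hm0c.mul continuous_const
  have hf2c : Continuous fun b => m0 b * W2 b := hm0c.mul hW2c
  obtain ⟨K1, hK1⟩ := isCompact_univ.exists_bound_of_continuousOn hf1c.continuousOn
  obtain ⟨K2, hK2⟩ := isCompact_univ.exists_bound_of_continuousOn hf2c.continuousOn
  have hmem1 : MemLp (fun b => m0 b * (fun _ => (1 : ℝ)) b) 2 (rectSliceMeasure (Matrix.specialUnitaryGroup (Fin 2) ℂ) Ls) :=
    MemLp.of_bound hf1c.aestronglyMeasurable K1 (Eventually.of_forall fun b => hK1 b (Set.mem_univ _))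
  have hmem2 : MemLp (fun b => m0 b * W2 b) 2 (rectSliceMeasure (Matrix.specialUnitaryGroup (Fin 2) ℂ) Ls) :=
    MemLp.of_bound hf2c.aestronglyMeasurable K2 (Eventually.of_forall fun b => hK2 b (Set.mem_univ _))
  -- the weight in the two normalisations
  have hw : ∀ c : RectSlice Ls (Matrix.specialUnitaryGroup (Fin 2) ℂ),
      (∏ e : RectTorusSite Ls × Fin k, Real.exp (J * (ρ (c e)).trace.re)) =
        ∏ e : RectTorusSite Ls × Fin k, Real.exp (β * su2a0 (c e)) := fun c =>
    Finset.prod_congr rfl fun e _ => by rw [hρdef, su2_weight_eq, hJ]; ring_nf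
  have hc0int : (∫ g, Real.exp (β * su2a0 g) ∂haarProbability (Matrix.specialUnitaryGroup (Fin 2) ℂ)) = c0 :=
    su2_integral_exp_su2a0_eq hβ.le
  -- gauge and twist invariance of `W2`
  have hW2g : ∀ (γ : RectTorusSite Ls → Matrix.specialUnitaryGroup (Fin 2) ℂ) (b : RectSlice Ls (Matrix.specialUnitaryGroup (Fin 2) ℂ)),
      W2 (fun e => γ e.1 * b e * (γ (e.1 + Pi.single e.2 1))⁻¹) = W2 b := by
    intro γ b
    simp only [hW2, hℓ]
    rw [prod_ofFn_rectLine_gauge, mul_assoc, su2a0_mul_comm, inv_mul_cancel_right]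
  have h1g : ∀ (γ : RectTorusSite Ls → Matrix.specialUnitaryGroup (Fin 2) ℂ) (b : RectSlice Ls (Matrix.specialUnitaryGroup (Fin 2) ℂ)),
      (fun _ : RectSlice Ls (Matrix.specialUnitaryGroup (Fin 2) ℂ) => (1 : ℝ))
        (fun e => γ e.1 * b e * (γ (e.1 + Pi.single e.2 1))⁻¹) = (fun _ => (1 : ℝ)) b := fun _ _ => rfl
  have hW2s : ∀ (s : Fin k → ZMod 2) (b : RectSlice Ls (Matrix.specialUnitaryGroup (Fin 2) ℂ)),
      W2 (rectFluxTwist su2MinusOne s b) = W2 b := by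
    intro s b
    simp only [hW2, hℓ]
    rw [prod_ofFn_rectLine_fluxTwist]
    split_ifs
    · exact chebyshevU_two_su2a0_su2MinusOne_mul _
    · rw [one_mul]
  -- reproducing properties
  have hrep2 : ∀ a : RectSlice Ls (Matrix.specialUnitaryGroup (Fin 2) ℂ),
      ∫ c, (∏ e : RectTorusSite Ls × Fin k, Real.exp (J * (ρ (c e)).trace.re)) * W2 (c * a)
        ∂(rectSliceMeasure (Matrix.specialUnitaryGroup (Fin 2) ℂ) Ls) = C2 * W2 a := by
    intro a
    simp_rw [hw]
    have h4 : ∀ c : RectSlice Ls (Matrix.specialUnitaryGroup (Fin 2) ℂ), W2 (c * a) =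
        (U ℝ ((2 : ℕ) : ℤ)).eval (su2a0 ((List.ofFn fun t : Fin (Ls μ) => c (ℓ t) * a (ℓ t)).prod)) := by
      intro c; simp only [hW2, Pi.mul_apply]
    simp_rw [h4]
    rw [su2_integral_prod_exp_mul_chebyshevU_rectLine hβ.le 2 ℓ (rectLine_injective μ) (fun t => a (ℓ t)), hc0int]
  have hrep1 : ∀ a : RectSlice Ls (Matrix.specialUnitaryGroup (Fin 2) ℂ),
      ∫ c, (∏ e : RectTorusSite Ls × Fin k, Real.exp (J * (ρ (c e)).trace.re)) * (fun _ => (1 : ℝ)) (c * a)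
        ∂(rectSliceMeasure (Matrix.specialUnitaryGroup (Fin 2) ℂ) Ls) = c0 ^ N * (fun _ => (1 : ℝ)) a := by
    intro a
    simp_rw [hw, mul_one]
    rw [show rectSliceMeasure (Matrix.specialUnitaryGroup (Fin 2) ℂ) Ls =
      Measure.pi (fun _ : RectTorusSite Ls × Fin k => haarProbability (Matrix.specialUnitaryGroup (Fin 2) ℂ)) from rfl,
      integral_fintype_prod_eq_prod (fun (_ : RectTorusSite Ls × Fin k) (g : Matrix.specialUnitaryGroup (Fin 2) ℂ) =>
        Real.exp (β * su2a0 g)), Finset.prod_const, Finset.card_univ, hc0int]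
  -- matrix elements
  have hA1 := inner_rectTubeTransferOperator_reproducingState_left ρ J (Ls := Ls) (continuous_fundamentalRep (Fin 2))
    continuous_const h1g hrep1 hmem1 hmem1
  have hA2 := inner_rectTubeTransferOperator_reproducingState_left ρ J (Ls := Ls) (continuous_fundamentalRep (Fin 2))
    hW2c hW2g hrep2 hmem2 hmem2
  have hA12 := inner_rectTubeTransferOperator_reproducingState_left ρ J (Ls := Ls) (continuous_fundamentalRep (Fin 2))
    hW2c hW2g hrep2 hmem1 hmem2
  -- `∫ W2 = 0` (the chain at `β = 0`)
  have hW2int : ∫ b, (fun _ => (1 : ℝ)) b * W2 b ∂(rectSliceMeasure (Matrix.specialUnitaryGroup (Fin 2) ℂ) Ls) = 0 := by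
    have h := su2_integral_prod_exp_mul_chebyshevU_rectLine (Ls := Ls) le_rfl 2 ℓ (rectLine_injective μ) (fun _ => 1)
    simp only [zero_mul, Real.exp_zero, Finset.prod_const_one, one_mul, mul_one] at h
    rw [besselISub_two_div_three_zero, zero_pow (NeZero.ne (Ls μ)), mul_zero, zero_mul] at h
    simp only [hW2, one_mul]
    exact h
  have hcross : @inner ℝ _ _ (hmem1.toLp _) (rectTubeTransferOperator ρ J Ls (hmem2.toLp _)) = 0 := by
    rw [hA12, hW2int, mul_zero]
  -- positivity and sizes of the constants
  have hc0pos : 0 < c0 := by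
    rw [← hc0int]
    exact integral_exp_pos ((Real.continuous_exp.comp (continuous_const.mul continuous_su2a0)).integrable_of_hasCompactSupport
      (HasCompactSupport.of_compactSpace _))
  have hq2pos : 0 < q2 := by
    rw [hq2, besselISub_div_succ hβ.ne' 2]
    exact div_pos (mul_pos two_pos (hIpos (2 + 1))) hβ
  have hq2le : q2 ≤ c0 := besselISub_div_succ_antitone hβ (Nat.zero_le 2)
  have hC2pos : 0 < C2 := mul_pos (pow_pos hc0pos _) (pow_pos hq2pos _)
  have hLN : Ls μ ≤ N := by
    have h := Fintype.card_le_of_injective _ (rectLine_injective (Ls := Ls) μ)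
    rwa [Fintype.card_fin] at h
  have hC2le : C2 ≤ c0 ^ N := by
    calc C2 = c0 ^ (N - Ls μ) * q2 ^ (Ls μ) := rfl
      _ ≤ c0 ^ (N - Ls μ) * c0 ^ (Ls μ) :=
          mul_le_mul_of_nonneg_left (pow_le_pow_left₀ hq2pos.le hq2le _) (pow_nonneg hc0pos.le _)
      _ = c0 ^ N := by rw [← pow_add, Nat.sub_add_cancel hLN]
  -- norms: `‖f_i‖² ≤ e^{βP} ∫ W_i²`
  have hJP : |J| * ((2 : ℕ) * ((Fintype.card (RectTorusSite Ls) : ℝ) *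
      (Fintype.card {p : Fin k × Fin k // p.1 < p.2} : ℝ))) = β * P := by
    rw [hJ, abs_of_pos (half_pos hβ)]; push_cast; ring
  have hm0sq : ∀ b, m0 b ^ 2 ≤ Real.exp (β * P) := by
    intro b
    rw [hm0, ← Real.exp_nat_mul]
    have h2 : ((2 : ℕ) : ℝ) * -(J / 2 * rectMagSum (Ls := Ls) ρ b) = -(J * rectMagSum (Ls := Ls) ρ b) := by
      push_cast; ring
    rw [h2, ← hJP]
    exact exp_neg_rectMagSum_le ρ J fundamentalRep_mem_unitaryGroup b
  have hnorm_le : ∀ {W : RectSlice Ls (Matrix.specialUnitaryGroup (Fin 2) ℂ) → ℝ} (hWc' : Continuous W)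
      (hmemW : MemLp (fun b => m0 b * W b) 2 (rectSliceMeasure (Matrix.specialUnitaryGroup (Fin 2) ℂ) Ls)),
      ‖hmemW.toLp _‖ ^ 2 ≤ Real.exp (β * P) * ∫ b, W b * W b ∂(rectSliceMeasure (Matrix.specialUnitaryGroup (Fin 2) ℂ) Ls) := by
    intro W hWc' hmemW
    have hW2i : Integrable (fun b => W b * W b) (rectSliceMeasure (Matrix.specialUnitaryGroup (Fin 2) ℂ) Ls) :=
      (hWc'.mul hWc').integrable_of_hasCompactSupport (HasCompactSupport.of_compactSpace _)
    rw [norm_sq_eq_integral_sq, ← integral_const_mul]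
    refine integral_mono_ae ((Lp.memLp (hmemW.toLp _)).integrable_sq) (hW2i.const_mul _) ?_
    filter_upwards [hmemW.coeFn_toLp] with b hb
    rw [hb, mul_pow, sq (W b)]
    exact mul_le_mul_of_nonneg_right (hm0sq b) (mul_self_nonneg _)
  -- apply the two-state bound with `m = e^{−βP} C2`
  have hP01 : rectTubeFluxProjection su2MinusOne Ls 0 (hmem1.toLp _) = hmem1.toLp _ := by
    have heig : ∀ s : Fin k → ZMod 2, rectFluxTwistOp Ls su2MinusOne s (hmem1.toLp _) = hmem1.toLp _ := by
      intro s
      have h := rectFluxTwistOp_toLp_eq_smul su2MinusOne s hmem1 1 fun b => by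
        simp only [hm0]; rw [rectMagSum_fluxTwist ρ su2MinusOne_mem_center]; ring
      rwa [one_smul] at h
    rw [rectTubeFluxProjection_apply_of_invariant su2MinusOne heig, if_pos rfl]
  have hP02 : rectTubeFluxProjection su2MinusOne Ls 0 (hmem2.toLp _) = hmem2.toLp _ := by
    have heig : ∀ s : Fin k → ZMod 2, rectFluxTwistOp Ls su2MinusOne s (hmem2.toLp _) = hmem2.toLp _ := by
      intro s
      have h := rectFluxTwistOp_toLp_eq_smul su2MinusOne s hmem2 1 fun b => by
        simp only [hm0]; rw [rectMagSum_fluxTwist ρ su2MinusOne_mem_center, hW2s]; ring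
      rwa [one_smul] at h
    rw [rectTubeFluxProjection_apply_of_invariant su2MinusOne heig, if_pos rfl]
  have hφf1 : @inner ℝ _ _ φ₀ (hmem1.toLp _) ≠ 0 := by
    refine ne_of_gt ?_
    rw [inner_eq_integral]
    refine integral_pos_of_ae_pos (integrable_mul φ₀ (hmem1.toLp _)) ?_
    unfold IsStrictlyPositiveFun at hpos
    filter_upwards [hpos, hmem1.coeFn_toLp] with b hb h1b
    rw [h1b]
    exact mul_pos hb (mul_pos (Real.exp_pos _) one_pos)
  have hA1' : Real.exp (-(β * P)) * C2 * ‖hmem1.toLp _‖ ^ 2 ≤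
      @inner ℝ _ _ (hmem1.toLp _) (rectTubeTransferOperator ρ J Ls (hmem1.toLp _)) := by
    rw [hA1]
    have hn := hnorm_le continuous_const hmem1
    have hint1 : ∫ b, (fun _ => (1 : ℝ)) b * (fun _ => (1 : ℝ)) b
        ∂(rectSliceMeasure (Matrix.specialUnitaryGroup (Fin 2) ℂ) Ls) = 1 := by simp
    rw [hint1] at hn ⊢
    rw [mul_one]
    have hee : Real.exp (-(β * P)) * Real.exp (β * P) = 1 := by
      rw [← Real.exp_add, neg_add_cancel, Real.exp_zero]
    calc Real.exp (-(β * P)) * C2 * ‖hmem1.toLp _‖ ^ 2 ≤ Real.exp (-(β * P)) * C2 * (Real.exp (β * P) * 1) :=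
          mul_le_mul_of_nonneg_left hn (mul_nonneg (Real.exp_pos _).le hC2pos.le)
      _ = (Real.exp (-(β * P)) * Real.exp (β * P)) * C2 := by ring
      _ = C2 := by rw [hee, one_mul]
      _ ≤ c0 ^ N := hC2le
  have hA2' : Real.exp (-(β * P)) * C2 * ‖hmem2.toLp _‖ ^ 2 ≤
      @inner ℝ _ _ (hmem2.toLp _) (rectTubeTransferOperator ρ J Ls (hmem2.toLp _)) := by
    rw [hA2]
    have hn := hnorm_le hW2c hmem2
    calc Real.exp (-(β * P)) * C2 * ‖hmem2.toLp _‖ ^ 2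
        ≤ Real.exp (-(β * P)) * C2 * (Real.exp (β * P) * ∫ b, W2 b * W2 b
            ∂(rectSliceMeasure (Matrix.specialUnitaryGroup (Fin 2) ℂ) Ls)) :=
          mul_le_mul_of_nonneg_left hn (mul_nonneg (Real.exp_pos _).le hC2pos.le)
      _ = (Real.exp (-(β * P)) * Real.exp (β * P)) * (C2 * ∫ b, W2 b * W2 b
            ∂(rectSliceMeasure (Matrix.specialUnitaryGroup (Fin 2) ℂ) Ls)) := by ring
      _ = C2 * ∫ b, W2 b * W2 b ∂(rectSliceMeasure (Matrix.specialUnitaryGroup (Fin 2) ℂ) Ls) := by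
          rw [← Real.exp_add, neg_add_cancel, Real.exp_zero, one_mul]
  have hA2pos : 0 < @inner ℝ _ _ (hmem2.toLp _) (rectTubeTransferOperator ρ J Ls (hmem2.toLp _)) := by
    rw [hA2]
    refine mul_pos hC2pos ?_
    have h3 : W2 1 = 3 := by
      simp only [hW2, Pi.one_apply, List.ofFn_const, List.prod_replicate, one_pow]
      have : su2a0 (1 : Matrix.specialUnitaryGroup (Fin 2) ℂ) = 1 := by
        unfold su2a0; simp [Matrix.trace_one]
      rw [this]
      have h := U_eval_one (R := ℝ) ((2 : ℕ) : ℤ)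
      push_cast at h ⊢
      linarith [h]
    refine Continuous.integral_pos_of_hasCompactSupport_nonneg_nonzero (x := 1) (hW2c.mul hW2c)
      (HasCompactSupport.of_compactSpace _) (fun b => mul_self_nonneg _) ?_
    rw [h3]; norm_num
  have htwo := rectTubeExcitedNorm_ge_half_of_two_states ρ J (Ls := Ls) (continuous_fundamentalRep (Fin 2))
    fundamentalRep_mem_unitaryGroup hvac hP01 hP02 hφf1 hcross (mul_nonneg (Real.exp_pos _).le hC2pos.le) hA1' hA2' hA2pos
  unfold su2RectExcitedNorm
  rw [show (β * ((Fintype.card (RectTorusSite Ls) : ℝ) * (Fintype.card {p : Fin k × Fin k // p.1 < p.2} : ℝ))) = β * P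
    by rw [hP]]
  calc Real.exp (-(β * P)) * (c0 ^ (N - Ls μ) * q2 ^ (Ls μ)) / 2 = Real.exp (-(β * P)) * C2 / 2 := by rw [hC2]
    _ ≤ rectTubeExcitedNorm ρ su2MinusOne J Ls := htwo

/-- **THE ONE-SIDED WINDOW FOR `m′`.**  On every rectangular `SU(2)` tube `Π_i ℤ/(Ls i)`, every axis `μ`, every `β > 0`:
`su2RectMassGapPrime β Ls ≤ (Ls μ)·(−log(I₃(β)/I₁(β))) + 2β·(#sites·k(k−1)/2) + log 2` — the `e = 0` gap never exceeds
the adjoint-torelon scale by more than `2β` per plaquette and `log 2` (`‖T‖ ≤ e^{β#P} c₀^N`, `su2_rectExcitedNorm_ge`,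
`(c₂/3)/c₀ = I₃/I₁`).  A consistency bound; no lower bound on `m′` is claimed. [cite: MontvayMunster1994, §3.2.6] -/
theorem su2RectMassGapPrime_le {β : ℝ} (hβ : 0 < β) (Ls : Fin k → ℕ) [∀ i, NeZero (Ls i)] (μ : Fin k) :
    su2RectMassGapPrime β Ls ≤
      ((Ls μ : ℕ) : ℝ) * (-Real.log (besselI 3 β / besselI 1 β)) +
        2 * β * (Fintype.card (RectTorusSite Ls) * Fintype.card {p : Fin k × Fin k // p.1 < p.2}) + Real.log 2 := by
  haveI : SecondCountableTopology (Matrix.specialUnitaryGroup (Fin 2) ℂ) := secondCountableTopology_su2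
  set P : ℝ := (Fintype.card (RectTorusSite Ls) : ℝ) * (Fintype.card {p : Fin k × Fin k // p.1 < p.2} : ℝ) with hP
  set N : ℕ := Fintype.card (RectTorusSite Ls × Fin k) with hN
  set c0 : ℝ := (besselI 0 β - besselI (0 + 2) β) / ((0 : ℕ) + 1) with hc0
  set q2 : ℝ := (besselI 2 β - besselI (2 + 2) β) / ((2 : ℕ) + 1) with hq2
  have hIpos : ∀ n : ℕ, 0 < besselI n β := fun n => by
    rw [besselI_eq_latticeModels_besselI]; exact Literature.Probability.LatticeModels.besselI_pos hβ _
  have hc0pos : 0 < c0 := by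
    rw [hc0, besselISub_div_succ hβ.ne' 0]
    exact div_pos (mul_pos two_pos (hIpos (0 + 1))) hβ
  have hq2pos : 0 < q2 := by
    rw [hq2, besselISub_div_succ hβ.ne' 2]
    exact div_pos (mul_pos two_pos (hIpos (2 + 1))) hβ
  have hLN : Ls μ ≤ N := by
    have h := Fintype.card_le_of_injective _ (rectLine_injective (Ls := Ls) μ)
    rwa [Fintype.card_fin] at h
  have hc0' : (∫ g : Matrix.specialUnitaryGroup (Fin 2) ℂ, Real.exp (β / 2 * ((fundamentalRep (Fin 2) g).trace).re)
      ∂haarProbability (Matrix.specialUnitaryGroup (Fin 2) ℂ)) = c0 := by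
    rw [hc0, ← su2_integral_exp_su2a0_eq hβ.le]
    exact integral_congr_ae (Eventually.of_forall fun U => by simp only [su2_weight_eq]; ring_nf)
  have hJ : |β / 2| * ((2 : ℕ) * ((Fintype.card (RectTorusSite Ls) : ℝ) *
      (Fintype.card {p : Fin k × Fin k // p.1 < p.2} : ℝ))) = β * P := by
    rw [abs_of_pos (half_pos hβ)]; push_cast; ring
  have hTle : ‖rectTubeTransferOperator (fundamentalRep (Fin 2)) (β / 2) Ls‖ ≤ Real.exp (β * P) * c0 ^ N := by
    have h := norm_rectTubeTransferOperator_le (fundamentalRep (Fin 2)) (β / 2) (Ls := Ls)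
      (continuous_fundamentalRep (Fin 2)) fundamentalRep_mem_unitaryGroup
    rwa [hc0', hJ] at h
  have hTpos : 0 < ‖rectTubeTransferOperator (fundamentalRep (Fin 2)) (β / 2) Ls‖ :=
    norm_rectTubeTransferOperator_pos (β / 2) Ls (continuous_fundamentalRep (Fin 2))
  have hEge : Real.exp (-(β * P)) * (c0 ^ (N - Ls μ) * q2 ^ (Ls μ)) / 2 ≤ su2RectExcitedNorm β Ls := by
    have h := su2_rectExcitedNorm_ge hβ Ls μ
    rwa [show (β * ((Fintype.card (RectTorusSite Ls) : ℝ) * (Fintype.card {p : Fin k × Fin k // p.1 < p.2} : ℝ))) = β * P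
      by rw [hP]] at h
  have hlowpos : 0 < Real.exp (-(β * P)) * (c0 ^ (N - Ls μ) * q2 ^ (Ls μ)) / 2 := by positivity
  have hEpos : 0 < su2RectExcitedNorm β Ls := lt_of_lt_of_le hlowpos hEge
  have h1 : Real.log ‖rectTubeTransferOperator (fundamentalRep (Fin 2)) (β / 2) Ls‖ ≤ β * P + (N : ℝ) * Real.log c0 := by
    have h := Real.log_le_log hTpos hTle
    rwa [Real.log_mul (Real.exp_pos _).ne' (pow_pos hc0pos _).ne', Real.log_exp, Real.log_pow] at h
  have h2 : -(β * P) + (((N - Ls μ : ℕ) : ℝ) * Real.log c0 + ((Ls μ : ℕ) : ℝ) * Real.log q2) - Real.log 2 ≤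
      Real.log (su2RectExcitedNorm β Ls) := by
    have h := Real.log_le_log hlowpos hEge
    rwa [Real.log_div (mul_pos (Real.exp_pos _) (mul_pos (pow_pos hc0pos _) (pow_pos hq2pos _))).ne' two_ne_zero,
      Real.log_mul (Real.exp_pos _).ne' (mul_pos (pow_pos hc0pos _) (pow_pos hq2pos _)).ne', Real.log_exp,
      Real.log_mul (pow_pos hc0pos _).ne' (pow_pos hq2pos _).ne', Real.log_pow, Real.log_pow] at h
  have hcast : (((N - Ls μ : ℕ) : ℝ)) = (N : ℝ) - ((Ls μ : ℕ) : ℝ) := by rw [Nat.cast_sub hLN]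
  rw [hcast] at h2
  have key : Real.log c0 - Real.log q2 = -Real.log (besselI 3 β / besselI 1 β) := by
    rw [← Real.log_div hc0pos.ne' hq2pos.ne', ← Real.log_inv]
    congr 1
    rw [hc0, hq2, besselISub_div_succ hβ.ne' 0, besselISub_div_succ hβ.ne' 2]
    have hI1 : besselI (0 + 1) β ≠ 0 := (hIpos (0 + 1)).ne'; have hI3 : besselI (2 + 1) β ≠ 0 := (hIpos (2 + 1)).ne'
    field_simp
  rw [su2RectMassGapPrime_eq]
  have h3 : ((Ls μ : ℕ) : ℝ) * (-Real.log (besselI 3 β / besselI 1 β)) =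
      ((Ls μ : ℕ) : ℝ) * Real.log c0 - ((Ls μ : ℕ) : ℝ) * Real.log q2 := by rw [← key]; ring
  rw [h3]
  linarith [h1, h2]

end SU2

end Summit.Ventures.YMGap.FlowData
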